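import Summits.QuantumFields.YangMills.Theorems.BalabanUVNodesN12FlatAveragedCoerciveOfForestSU2Chart
import Literature.MathematicalPhysics.QuantumFieldTheory.Balaban1983to89.Node00.MultiScaleFibreChartB
import Summits.QuantumFields.YangMills.Theorems.BalabanUVNodesN12FlatAveragedCoerciveOfForestLam
import Summits.QuantumFields.YangMills.Theorems.BalabanUVNodesN12FlatChartDerivIterLinB
import HarnessLib

/-!
# DAG node N12 [B15] — THE FLAT «LEMMA 2.4»-SHAPED COERCIVITY (P♭Q) ON THE FOREST SLICE OF `𝐁_k(Z)` IN THE (β)-SPLIT's OWN CURRENCY (`ℝ³` bond fields, dag-n12-c's `su2Chart`, NODE 00's — **BOND-DATUM EDITION** (`…N12FlatAveragedCoerciveOfForestSU2ChartB`, USED DECLARATIONS ONLY)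

The print-datum ([Balaban1984PropagatorsII] (2.3)) (γ) twin of `Summits/…/Theorems/BalabanUVNodesN12FlatAveragedCoerciveOfForestSU2Chart.lean`: the declarations of the parent whose STATEMENT reads the determining datum
(`exists_flatAveragedCoercive_forest_Bj_su2Chart`) and which N12's junction of record v14ᴸ uses (dag-n12-c g35 probe-2 census `UsedConstsN12RoadTyped2`, THEOREMS block), re-typed over a
BOND-LEVEL datum `𝔅 : BDetSet` (F0a `B15DeterminingSetsB`) and dag-n12-c's bond-datum chart `Node00.msChartB` (✓p774329; `msChart 𝐁 = msChartB (bondsDet 𝐁)` by `rfl`).  GENERATOR twin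
(this seat's `work/g32/gen_thm.py`, block-extracted from the parent's tree bytes): namespace `…N12FlatAveragedCoerciveOfForestSU2ChartB`, SAME short names, `DetSet ↦ BDetSet`, `AgreeOn 𝐁 ↦ AgreeOnB 𝔅`,
`IsMinimizer ↦ IsMinimizerB`, `bondsOf (𝐁 j) ↦ 𝔅 j`, `msChart ∕ constrCard ∕ constrEnum ∕ ConstrSet ↦ …B`, NODE 00 chart lemmas `…msChart… ↦ …msChartB…`; proofs VERBATIM; the parent's
datum-free declarations REUSED BY NAME (`open`), never copied (private plumbing excepted, №366 R2).  The parent's (b) statements are the instances `𝔅 := bondsDet 𝐁`.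

Cell `pub-ymgap` (HUMAN RULINGS D-0062 ∕ D-0149), seat `pub-ymgap-dag-n12-d` g32 (R134 N12 [B15] s2; the (ii) Theorems-side re-key of N12's road at print's [II] (2.3) datum — director-ym №338 ∕
№343 (E1)(iii-b), FLAG №16 ∕ ruling (α); dag-n12-c DESIGN memo a793b2ebc0b803bf (ii); `N12-ROAD-TWIN-ORDER-2026-08-30.md`).  Count-neutral helper of K1⁹ `stmt-QuantumFields-27364`,
`--kind proof --supports … --as helper`.  THEOREMS ONLY (0 `def`, 0 `instance`, 0 `sorry`).

HONEST FRAMING (director-ym №338 (5)).  PURELY ADDITIVE: the parent stays landed and true on its own text; nothing in it is edited; no displayed premise of any consumer is deleted or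
weakened; every hypothesis of the parent stays a hypothesis.  Nothing of Bałaban's analysis asserted; N12 NOT discharged; K0⁷ ∕ K1⁹ NOT closed; counts unmoved (typed 28∕28 · discharged
8∕27, A 8∕28; K 1∕4); one finite 𝕋⁴ programme at fixed ε — R4 closes the conditional rung `BalabanLadder.UV` only; NOT the Yang–Mills mass gap (Clay); nothing continuum ∕ ℝ⁴ ∕ OS.

PARENT's DOCSTRING (the mathematics and the citations; read the site-level `𝐁` as the bond datum `𝔅`):
# DAG node N12 [B15] — THE FLAT «LEMMA 2.4»-SHAPED COERCIVITY (P♭Q) ON THE FOREST SLICE OF `𝐁_k(Z)` IN THE (β)-SPLIT's OWN CURRENCY (`ℝ³` bond fields, dag-n12-c's `su2Chart`, NODE 00's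
# `Q_j(1) = dIterL j 1`), PER INSTANCE: the letter (P♭Q) of `B15Prop1FlatCoerciveSplit` INHABITED at the record's flat chart

[Balaban1984PropagatorsII] = «[B6]», Lemma 2.4 (2.128) p. 245, (2.153) p. 249; [Balaban1989LargeFieldII] = «[LF-II]», p. 357, (1.7)–(1.9) p. 358, (1.19) p. 360; [Balaban1985Variational] = «[15]», (44)–(48)
p. 285, (82)–(83) p. 290; [Balaban1985Averaging] (17)–(19) p. 21, Prop. 3 (121)–(125) p. 36; [Balaban1988Convergent] = «[III]», (2.2) p. 255, (2.10)–(2.13) pp. 256–257.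

Cell `pub-ymgap`, HUMAN RULINGS D-0062 ∕ D-0149, lane owner `pub-ymgap-dag-n12-c` (g25, strategy s1).  Key K1⁹ `stmt-QuantumFields-27364`, `--kind proof --supports … --as helper`; count-neutral.
NEW leaf; CONSUMED BY NAME, nothing modified: the lane's `…N12FlatAveragedCoerciveOfForest.exists_flatAveragedCoercive_forest_Bj` (g25; (P♭Q) per instance in NODE 00's `msChart` currency), dag-n12-w3's
`…N12FlatChartDerivIterLin.fderiv_msChart_one_apply_eq_iterLin` (`DΦ_flat(0) = π ∘ Q^{(·)}`), NODE 00's `Node00.dIterL_one_apply_of_skew` (`Q_k(1)` IS the `linAvg` recursion on skew fields),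
dag-n12-w2∕w3's `B16Ineq19FlatSliceChart.expMul_su2Chart_smul_one_eq_expChart` ∕ `norm_sq_lieSU2Coord` ∕ `exists_lieSU2Coord` (the `ℝ³ ↔ 𝔰𝔲(2)` coordinate: left chart at `1` = right chart at `1`,
`‖φ v‖² = 2‖v‖²`), `B15SU2ChartHolomorphic.quatMatrix_imQuat` (`↑(φ v) = Σ_a v_a E_a`), the lane's `…N12DirectChartPackageOfClassL1Family.pi_norm_sq_le_sum_norm_sq` (sup-norm bookkeeping).

WHY (lane memo `N12-UNIFORMITY-SPEC.md` §8).  `B15Prop1FlatCoerciveSplit.flatCoercive_of_flatAveragedCoercive_of_flatAverageBound` reduces the (β)-split's flat coercivity letter (P) to (P♭Q) + (L), with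
(P♭Q) stated in the split's currency: `c♭·Σ_b‖p_b‖² ≤ d²∕ds² A(expMul su2Chart (s•p) 1)|₀ + Σ_i ‖(dIterL j_i ↑1 p̂)(c_i)‖²`, `p̂_b = Σ_a p_{b,a}E_a`, for every real field `p` of the slice.  The
companion file proved (P♭Q) per instance in NODE 00's currency (`𝔰𝔲(N)` fields, `expChart` at `1`, `‖DΦ_flat(0)X‖²`).  THIS FILE transports it: `X := φ∘p` (`φ` the `𝔰𝔲(2)` coordinate of
`su2Chart`), `Σ_b‖X_b‖² = 2Σ_b‖p_b‖²`, the two flat second variations coincide, and `‖DΦ_flat(0)X‖² ≤ 2·Σ_i‖(dIterL j_i ↑1 p̂)(c_i)‖²` (`DΦ_flat(0)X_i = π((Q^{(j_i)}↑X)(c_i)) = (dIterL j_i ↑1 p̂)(c_i)` read in `𝔰𝔲(2)`, whose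
Hilbert–Schmidt norm is `√2`× the operator norm; `Q^{(j)}↑X = dIterL j ↑1 p̂` on the skew field `↑X = p̂`).

CONTENTS (namespace `Summit.QuantumFields.YangMills.BalabanUVNodes.N12FlatAveragedCoerciveOfForestSU2Chart`; theorems only, no `def`, no `instance`, no `sorry`).
`norm_sq_lieSU_two_eq_two_mul` (`‖X‖²_{𝔰𝔲(2),HS} = 2‖↑X‖²_{op}`) · ★★★ `exists_flatAveragedCoercive_forest_Bj_su2Chart` — `∃ c♭ > 0, ∀ p` vanishing on the forest's path bonds,
`c♭·Σ_b‖p_b‖² ≤ d²∕ds² A(expMul su2Chart (s•p) 1)|₀ + Σ_i ‖(dIterL j_i (↑(1 : SU2-field)) p̂)(c_i)‖²` — the (P♭Q) letter of `B15Prop1FlatCoerciveSplit` for the forest slice of `𝐁_k(Z)` (at the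
record the slice letter (F3) reads exactly «vanishes on every path bond»), constant existential per instance; w3's binders verbatim (`1 ≤ k ≤ m + K`, `1 ≤ M₁`, cover divisibility, (TREE)).

HONEST FRAMING ∕ LOCATED.  Dictionary bookkeeping over the companion's compactness theorem; `c♭` EXISTENTIAL per instance (U4 grade), not print's `(12d²)⁻¹L^{−d−1}`; nothing of Bałaban's estimates
asserted; count-neutral helper; N12 NOT discharged; K1⁹ NOT closed; counts unmoved; one finite 𝕋⁴ programme at fixed ε — R4 closes the conditional finite-𝕋⁴ rung `BalabanLadder.UV` only; NOT
continuum ∕ OS ∕ mass gap ∕ Clay.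
-/

noncomputable section

open scoped BigOperators Matrix.Norms.L2Operator Topology

namespace Summit.QuantumFields.YangMills.BalabanUVNodes.N12FlatAveragedCoerciveOfForestSU2ChartB

open Literature.MathematicalPhysics.QuantumFieldTheory.Balaban1983to89.B15DeterminingSetsB

open Set Metric Filter
open Literature.MathematicalPhysics.QuantumFieldTheory.Balaban1983to89
open T4Continuum B15DeterminingSets GaugeField
open T4AdjointCovarianceUnitary (lieSU mem_lieSU_iff)
open Node00
open Literature.MathematicalPhysics.QuantumFieldTheory.Balaban1983to89.B14.Eq213DetSet (Bj)
open Literature.MathematicalPhysics.QuantumFieldTheory.Balaban1983to89.B14.Eq213MaximalDomains (side)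
open BlockAveragingEMLLinearised (linAvg)
open B15SU2ChartHolomorphic (genE quatMatrix_imQuat)
open B15Prop1ChartCalculusSU2 (E3)
open B15Prop1ChartSU2 (su2Chart)
open B16Sect1Backgrounds (expMul)
open T4CubeChartGnomonic (SU2)
open T4HaarSU2ExpChart (imQuat)
open Literature.MathematicalPhysics.QuantumLattice (quatMatrix)
open B16Ineq19FlatSliceChart (exists_lieSU2Coord expMul_su2Chart_smul_one_eq_expChart norm_sq_lieSU2Coord)
open B16Ineq19NearFlatSlice (norm_coe_lieSU2Coord)
open B15Prop1LinearisedKernelDictionary (exists_coord_of_mem_lieSU_two)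
open Summit.QuantumFields.YangMills.BalabanUVNodes.N12FlatAveragedCoerciveOfForestLam (exists_flatAveragedCoercive_forest_lamBondsSeq)
open Summit.QuantumFields.YangMills.BalabanUVNodes.N12FlatChartDerivIterLin (iterLin_mem_lieSU)
open Summit.QuantumFields.YangMills.BalabanUVNodes.N12FlatChartDerivIterLinB (fderiv_msChart_one_apply_eq_iterLin)
open Summit.QuantumFields.YangMills.BalabanUVNodes.N12DirectChartPackageOfClassL1Family (pi_norm_sq_le_sum_norm_sq)
open Literature.MathematicalPhysics.QuantumFieldTheory.Balaban1983to89.B14.Eq213DetSet (maxDomT)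
open Summit.QuantumFields.YangMills.BalabanUVNodes.N12FlatAveragedCoerciveOfForestSU2Chart (norm_sq_lieSU_two_eq_two_mul)

section
variable {F : T4Family} {K k : ℕ} {M₁ : ℕ} {Z : Set (Site (F.P K) 0)}

/-- ★★★ **(P♭Q) ON THE FOREST SLICE OF `𝐁_k(Z)` IN THE (β)-SPLIT's CURRENCY, PER INSTANCE.**  For the record's determining set `𝐁_k(Z)` (`1 ≤ k ≤ m + K`, `1 ≤ M₁`, cover divisibility) and a
forest `path` with (TREE), there is `c♭ > 0` such that every `ℝ³`-valued bond field `p` vanishing on the forest's path bonds satisfies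
`c♭·Σ_b‖p_b‖² ≤ d²∕ds² A(expMul su2Chart (s•p) 1)|₀ + Σ_i ‖(dIterL j_i ↑1 p̂)(c_i)‖²` (`p̂_b = Σ_a p_{b,a}E_a`; `i` over the constrained bonds `(j_i, c_i)` of `𝐁_k(Z)` below `k`) — the
letter (P♭Q) of `B15Prop1FlatCoerciveSplit` ([B6] (2.128)'s shape), transported from the companion's `msChartB`-currency theorem along `X := φ∘p`.
[cite: Balaban1984PropagatorsII, Lemma 2.4 (2.128) p.245, (2.153) p.249; Balaban1989LargeFieldII, p.357, (1.9) p.358, (1.19) p.360; Balaban1985Variational, (44)–(48) p.285, (82)–(83) p.290; Balaban1985Averaging, (17)–(19) p.21, Prop. 3 (121)–(125) p.36; Balaban1988Convergent, (2.2) p.255, (2.10)–(2.13) pp.256–257] -/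
theorem exists_flatAveragedCoercive_forest_lamBondsSeq_su2Chart (hk : k ≤ (F.P K).m + (F.P K).K) (hk1 : 1 ≤ k) (hM : 1 ≤ M₁)
    (hdiv : side (F.P K).L M₁ k ∣ (F.P K).sitesPerDir 0)
    {path : Site (F.P K) 0 → List (LStep (F.P K) 0)}
    (htree : ∀ x : Site (F.P K) 0, x ∉ {z : Site (F.P K) 0 | ∃ j, j ≤ k ∧ ∃ c ∈ ((lamBondsSeq (maxDomT M₁ Z) k : BDetSet (F.P K)) j), (z = embIter j c.src ∨ z = embIter j c.tgt)} →
      ∃ (x' : Site (F.P K) 0) (s : LStep (F.P K) 0), path x = path x' ++ [s] ∧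
        (s.fwd = true → s.bond.src = x' ∧ s.bond.tgt = x) ∧ (s.fwd = false → s.bond.src = x ∧ s.bond.tgt = x')) :
    ∃ cflat : ℝ, 0 < cflat ∧ ∀ p : VecField (F.P K) 0 E3, (∀ x, ∀ s ∈ path x, p s.bond = 0) →
      cflat * ∑ b : PBond (F.P K) 0, ‖p b‖ ^ 2 ≤
        deriv (deriv fun s : ℝ => wilsonAction4 (expMul su2Chart (s • p) (1 : GaugeField (F.P K) 0 SU2))) 0 +
          ∑ i : Fin (constrCardB (lamBondsSeq (maxDomT M₁ Z) k : BDetSet (F.P K)) k),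
            ‖dIterL (((constrEnumB (lamBondsSeq (maxDomT M₁ Z) k : BDetSet (F.P K)) k).symm i).1 : ℕ) (coeField (1 : GaugeField (F.P K) 0 SU2))
              (fun b => ∑ a : Fin 3, ((p b a : ℝ) : ℂ) • genE a) ((constrEnumB (lamBondsSeq (maxDomT M₁ Z) k : BDetSet (F.P K)) k).symm i).2.1‖ ^ 2 := by
  obtain ⟨φ, hφ⟩ := exists_lieSU2Coord
  obtain ⟨c, hc, hcle⟩ := exists_flatAveragedCoercive_forest_lamBondsSeq (F := F) (N := 2) (Z := Z) hk hk1 hM hdiv htree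
  -- the `linAvg` recursion family and the flat linearised averaging on skew fields
  obtain ⟨Q, hQ0, hQs⟩ : ∃ Q : (i : ℕ) → (PBond (F.P K) 0 → Matrix (Fin 2) (Fin 2) ℂ) → PBond (F.P K) i → Matrix (Fin 2) (Fin 2) ℂ,
      (∀ Y, Q 0 Y = Y) ∧ ∀ (i : ℕ) (Y : PBond (F.P K) 0 → Matrix (Fin 2) (Fin 2) ℂ) (c : PBond (F.P K) (i + 1)), Q (i + 1) Y c = linAvg (Q i Y) c :=
    ⟨fun i => Nat.rec (motive := fun i => (PBond (F.P K) 0 → Matrix (Fin 2) (Fin 2) ℂ) → PBond (F.P K) i → Matrix (Fin 2) (Fin 2) ℂ) (fun Y => Y)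
      (fun _ Qi Y c => linAvg (Qi Y) c) i, fun _ => rfl, fun _ _ _ => rfl⟩
  refine ⟨c, hc, fun p hp => ?_⟩
  -- the coordinate field `X := φ ∘ p` lies in the forest slice
  set X : PBond (F.P K) 0 → lieSU (Fin 2) := fun b => φ (p b) with hXdef
  have hX : ∀ x, ∀ s ∈ path x, X s.bond = 0 := fun x s hs => by
    show φ (p s.bond) = 0
    rw [hp x s hs, map_zero]
  have hmain := hcle X hX
  -- (i) the masses: `Σ_b ‖X_b‖² = 2·Σ_b ‖p_b‖²`
  have hmass : ∑ b : PBond (F.P K) 0, ‖X b‖ ^ 2 = 2 * ∑ b : PBond (F.P K) 0, ‖p b‖ ^ 2 := by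
    rw [Finset.mul_sum]
    exact Finset.sum_congr rfl fun b _ => norm_sq_lieSU2Coord hφ (p b)
  -- (ii) the flat second variations coincide (left chart at `1` = right chart at `1`)
  have hflat : (fun s : ℝ => wilsonAction4 (expMul su2Chart (s • p) (1 : GaugeField (F.P K) 0 SU2))) =
      fun s : ℝ => wilsonAction4 (expChart (1 : GaugeField (F.P K) 0 (SU 2)) (s • X)) := by
    funext s
    rw [expMul_su2Chart_smul_one_eq_expChart hφ p s]
  -- (iii) the flat linearised constraint: component `i` is `π((dIterL j_i ↑1 p̂)(c_i))`, an element of `𝔰𝔲(2)`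
  have hXcoe : (fun b => ((X b : lieSU (Fin 2)) : Matrix (Fin 2) (Fin 2) ℂ)) = fun b => ∑ a : Fin 3, ((p b a : ℝ) : ℂ) • genE a := by
    funext b
    show ((φ (p b) : lieSU (Fin 2)) : Matrix (Fin 2) (Fin 2) ℂ) = _
    rw [hφ, quatMatrix_imQuat]
  have hmem : ∀ b, (fun b => ∑ a : Fin 3, ((p b a : ℝ) : ℂ) • genE a) b ∈ lieSU (Fin 2) := by
    intro b
    rw [← hXcoe]
    exact (X b).2
  have hskew : ∀ b, star ((fun b => ∑ a : Fin 3, ((p b a : ℝ) : ℂ) • genE a) b) = -((fun b => ∑ a : Fin 3, ((p b a : ℝ) : ℂ) • genE a) b) :=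
    fun b => (mem_lieSU_iff.1 (hmem b)).1
  have hone : coeField (1 : GaugeField (F.P K) 0 SU2) = (1 : PBond (F.P K) 0 → Matrix (Fin 2) (Fin 2) ℂ) := by
    funext b; rfl
  have hcomp : ∀ i : Fin (constrCardB (lamBondsSeq (maxDomT M₁ Z) k : BDetSet (F.P K)) k),
      ‖fderiv ℝ (msChartB F 2 K k (lamBondsSeq (maxDomT M₁ Z) k) (avgFamily (avOfRecord F 2 K) (1 : GaugeField (F.P K) 0 (SU 2))) (1 : GaugeField (F.P K) 0 (SU 2))) 0 X i‖ ^ 2 =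
        2 * ‖dIterL (((constrEnumB (lamBondsSeq (maxDomT M₁ Z) k : BDetSet (F.P K)) k).symm i).1 : ℕ) (coeField (1 : GaugeField (F.P K) 0 SU2))
          (fun b => ∑ a : Fin 3, ((p b a : ℝ) : ℂ) • genE a) ((constrEnumB (lamBondsSeq (maxDomT M₁ Z) k : BDetSet (F.P K)) k).symm i).2.1‖ ^ 2 := by
    intro i
    have hQmem := iterLin_mem_lieSU Q hQ0 hQs hmem (((constrEnumB (lamBondsSeq (maxDomT M₁ Z) k : BDetSet (F.P K)) k).symm i).1 : ℕ)
      ((constrEnumB (lamBondsSeq (maxDomT M₁ Z) k : BDetSet (F.P K)) k).symm i).2.1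
    have hQeq : Q (((constrEnumB (lamBondsSeq (maxDomT M₁ Z) k : BDetSet (F.P K)) k).symm i).1 : ℕ) (fun b => ∑ a : Fin 3, ((p b a : ℝ) : ℂ) • genE a)
        ((constrEnumB (lamBondsSeq (maxDomT M₁ Z) k : BDetSet (F.P K)) k).symm i).2.1 =
        dIterL (((constrEnumB (lamBondsSeq (maxDomT M₁ Z) k : BDetSet (F.P K)) k).symm i).1 : ℕ) (coeField (1 : GaugeField (F.P K) 0 SU2))
          (fun b => ∑ a : Fin 3, ((p b a : ℝ) : ℂ) • genE a) ((constrEnumB (lamBondsSeq (maxDomT M₁ Z) k : BDetSet (F.P K)) k).symm i).2.1 := by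
      rw [hone, (dIterL_one_apply_of_skew Q hQ0 hQs hskew _).1]
    rw [fderiv_msChart_one_apply_eq_iterLin Q hQ0 hQs (lamBondsSeq (maxDomT M₁ Z) k) X i, hXcoe]
    have hproj : suProj 2 (Q (((constrEnumB (lamBondsSeq (maxDomT M₁ Z) k : BDetSet (F.P K)) k).symm i).1 : ℕ) (fun b => ∑ a : Fin 3, ((p b a : ℝ) : ℂ) • genE a)
        ((constrEnumB (lamBondsSeq (maxDomT M₁ Z) k : BDetSet (F.P K)) k).symm i).2.1) = ⟨_, hQmem⟩ := suProj_coe ⟨_, hQmem⟩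
    rw [hproj, norm_sq_lieSU_two_eq_two_mul]
    exact congrArg (fun M : Matrix (Fin 2) (Fin 2) ℂ => 2 * ‖M‖ ^ 2) hQeq
  have hDΦ : ‖fderiv ℝ (msChartB F 2 K k (lamBondsSeq (maxDomT M₁ Z) k) (avgFamily (avOfRecord F 2 K) (1 : GaugeField (F.P K) 0 (SU 2))) (1 : GaugeField (F.P K) 0 (SU 2))) 0 X‖ ^ 2 ≤
      2 * ∑ i : Fin (constrCardB (lamBondsSeq (maxDomT M₁ Z) k : BDetSet (F.P K)) k),
        ‖dIterL (((constrEnumB (lamBondsSeq (maxDomT M₁ Z) k : BDetSet (F.P K)) k).symm i).1 : ℕ) (coeField (1 : GaugeField (F.P K) 0 SU2))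
          (fun b => ∑ a : Fin 3, ((p b a : ℝ) : ℂ) • genE a) ((constrEnumB (lamBondsSeq (maxDomT M₁ Z) k : BDetSet (F.P K)) k).symm i).2.1‖ ^ 2 := by
    refine (pi_norm_sq_le_sum_norm_sq _).trans (le_of_eq ?_)
    rw [Finset.mul_sum]
    exact Finset.sum_congr rfl fun i _ => hcomp i
  -- assemble: `c·(2m) ≤ A + ‖DΦ X‖² ≤ A + 2S` and `A ≥ 0` give `c·m ≤ A + S`
  have hflat0 : 0 ≤ deriv (deriv fun s : ℝ => wilsonAction4 (expChart (1 : GaugeField (F.P K) 0 (SU 2)) (s • X))) 0 :=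
    N12FlatChartHnd.deriv_deriv_wilsonAction4_expChart_one_nonneg X
  rw [hflat]
  rw [hmass] at hmain
  linarith [hmain, hDΦ, hflat0]

end

end Summit.QuantumFields.YangMills.BalabanUVNodes.N12FlatAveragedCoerciveOfForestSU2ChartB

end
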